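import Summits.BirchSwinnertonDyer.Rank1Residual.X5.TwoAdicTargetsTowerGap
import HarnessLib

/-!
# Crux Kμ⁺ `SignedMuVanishingAtTwoPlus` (stmt-BirchSwinnertonDyer-20689) / seed 21438, fine half (F): μ-RIGIDITY OF CYCLIC
# IWASAWA MODULES AT A FINITE LAYER — the kernel form of `Cruxes/SignedMuVanishingAtTwoPlus/D4Reading.md`

Cell `bsd-wall`, lead `bsd-wall-rtt-p4` g11 (helper, `--supports stmt-BirchSwinnertonDyer-20689`; THEOREMS ONLY, route-independent pure
`Λ`-algebra over `Λ = IwasawaAlgebra p = ℤ_p⟦T⟧`; no `def`, no named fact, no `sorry`). BSD is not proved by this; nothing about any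
curve or number field is asserted.

Context. The fine half (F) of the seed item 21438 for ONE habitat⁺ class (406203s1, the last class of the `N ≤ 5·10⁵` census undecided
at layer 3) is being decided numerically at layer 4 of the cyclotomic `ℤ₂`-tower of its cubic field `k` (kit jobs j311634, j312193–6):
with one totally ramified prime, `A_n ≅ X/ω_n X` for `X = X_nr(k_∞)`, `ω_n = (1+T)^{2ⁿ} − 1`, and the data are `#A_n = 2^{2ⁿ}`,
`rk₂ A_n = 2ⁿ` (`n ≤ 3`), `rk₂ A₀ = 1` (so `X ≅ Λ/I` is cyclic). This file proves the algebra behind the reading rule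
«μ ≥ 1 FORCES `X ≅ Λ/p` exactly; hence ANY deviation at a later layer proves μ = 0»:

* `span_singleton_le_of_le_of_mem_sup` — over a LOCAL ring: `I ≤ (a)`, `a ∈ I + (ν)`, `a ∉ (ν)` ⇒ `(a) ≤ I` (write `a = ja + νh`;
  if `j` were a non-unit, `1 − j` is a unit and `a = νh(1−j)⁻¹ ∈ (ν)`).
* `C_p_not_mem_span_omega` — `p ∉ (ω_n)` in `Λ` (constant coefficients: `ω_n(0) = 0`, cf. `KatoHalfPinch.constantCoeff_omega`).
* `eq_span_C_p_of_le_of_mem_sup` — **rigidity**: an ideal `I ≤ (p)` («μ(Λ/I) ≥ 1») with `p ∈ I + (ω_n)` for ONE `n` is `I = (p)`;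
  `eq_span_C_p_of_le_of_natCard_eq` — the same from the COUNT `#Λ/(I + (ω_n)) = #Λ/(p, ω_n)` (the observed `e_n = pⁿ·1`, e.g. `e₃ = 8`
  at `p = 2`); then `sup_span_omega_eq_towerIdeal_of_eq` — EVERY layer is `Λ/(I + (ω_m)) = Λ/(p, T^{p^m}) = 𝔽_p[T]/(T^{p^m})`.
* `exists_not_dvd_or_eq_span_C_p_of_natCard_eq` — **the dichotomy used by the census**: for a cyclic `Λ/I` whose `n`-th layer has
  the count of `Λ/(p, ω_n)`, EITHER some element of `I` is not divisible by `p` (μ = 0 in the tree's currency `¬ C p ∣ ·`) OR `I = (p)`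
  (and then all layers are `𝔽_p[T]/(T^{p^m})`: `d_m = e_m = p^m` for every `m`). Contrapositive: a layer-`m` quotient NOT of that
  shape (at `p = 2`, layer 4: `d₄ ≤ 15`, or `e₄ ≠ 16`, or `A₄` not elementary abelian) certifies μ = 0.

References: [Washington1997] §13.3 (Lemma 13.15, Prop. 13.19, 13.22: `A_n ≅ X/ν_{n,0}Y₀`, one ramified prime); [Lang1990] Ch. 5 §1–§2;
[GreenbergLNM1716] §3. The statements are elementary commutative algebra serving the numerical reading; they are not printed theorems.
-/

set_option autoImplicit false
-- justification: the `Summit.BirchSwinnertonDyer.BirchSwinnertonDyer.…` path repeats a component (route-file convention)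
set_option linter.dupNamespace false

noncomputable section

open scoped Classical

open Literature.NumberTheory.EllipticCurves IsLocalRing
  Summit.BirchSwinnertonDyer.Rank1Residual.X5.TowerGap

namespace Summit.BirchSwinnertonDyer.BirchSwinnertonDyer.Theorems.SignedMuAtTwo.CyclicMuRigidity

/-! ## §1. The local-ring lemma -/

/-- **Over a local ring: `I ≤ (a)`, `a ∈ I + (ν)` and `a ∉ (ν)` force `(a) ≤ I`.** Write `a = i + y` with `i ∈ I`, `y ∈ (ν)`,
and `i = j·a`; if `j` is a non-unit then `1 − j` is a unit and `a·(1 − j) = y ∈ (ν)` puts `a ∈ (ν)`; so `j` is a unit and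
`a = j⁻¹ i ∈ I`. [folklore] -/
theorem span_singleton_le_of_le_of_mem_sup {R : Type*} [CommRing R] [IsLocalRing R] {I : Ideal R} {a ν : R}
    (hI : I ≤ Ideal.span {a}) (ha : a ∈ I ⊔ Ideal.span {ν}) (hν : a ∉ Ideal.span {ν}) : Ideal.span {a} ≤ I := by
  obtain ⟨i, hi, y, hy, hiy⟩ := Submodule.mem_sup.mp ha
  obtain ⟨j, hj⟩ := Ideal.mem_span_singleton'.mp (hI hi)
  -- `hj : j * a = i`
  rcases IsLocalRing.isUnit_or_isUnit_one_sub_self j with hju | hju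
  · -- `j` a unit: `a = j⁻¹ i ∈ I`
    rw [Ideal.span_singleton_le_iff_mem]
    have : a = ↑hju.unit⁻¹ * i := by
      rw [← hj, ← mul_assoc, IsUnit.val_inv_mul, one_mul]
    rw [this]
    exact I.mul_mem_left _ hi
  · -- `1 - j` a unit: `a (1 - j) = y ∈ (ν)`, so `a ∈ (ν)` — contradiction
    exfalso
    apply hν
    have hay : a * (1 - j) = y := by
      have : a = i + y := hiy.symm
      calc a * (1 - j) = a - j * a := by ring
        _ = y := by rw [hj, this]; ring
    have : a = y * ↑hju.unit⁻¹ := by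
      rw [← hay, mul_assoc, IsUnit.mul_val_inv, mul_one]
    rw [this]
    exact (Ideal.span {ν}).mul_mem_right _ hy

/-! ## §2. `p ∉ (ω_n)` in `Λ = ℤ_p⟦T⟧` -/

variable (p : ℕ) [hp : Fact p.Prime]

/-- **`p ∉ (ω_n)`**: a multiple of `ω_n` has constant coefficient `0`, while `p ≠ 0` in `ℤ_p`. [folklore] -/
theorem C_p_not_mem_span_omega (n : ℕ) :
    (PowerSeries.C (p : ℤ_[p]) : IwasawaAlgebra p) ∉ Ideal.span {omega p n} := by
  intro h
  obtain ⟨c, hc⟩ := Ideal.mem_span_singleton'.mp h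
  have hω : PowerSeries.constantCoeff (omega p n) = 0 := by simp [omega]
  have h0 := congrArg PowerSeries.constantCoeff hc
  rw [map_mul, hω, mul_zero, PowerSeries.constantCoeff_C] at h0
  exact (NeZero.ne (p : ℤ_[p])) h0.symm

/-! ## §3. Rigidity: `I ≤ (p)` and one full layer force `I = (p)` -/

/-- **μ-rigidity of a cyclic module at one layer.** If `I ≤ (p)` (the cyclic module `Λ/I` has «μ ≥ 1»: every element of `I` is
divisible by `p`) and `p ∈ I + (ω_n)` for ONE `n`, then `I = (p)`. [folklore] -/
theorem eq_span_C_p_of_le_of_mem_sup {I : Ideal (IwasawaAlgebra p)}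
    (hI : I ≤ Ideal.span {(PowerSeries.C (p : ℤ_[p]) : IwasawaAlgebra p)}) (n : ℕ)
    (hmem : (PowerSeries.C (p : ℤ_[p]) : IwasawaAlgebra p) ∈ I ⊔ Ideal.span {omega p n}) :
    I = Ideal.span {(PowerSeries.C (p : ℤ_[p]) : IwasawaAlgebra p)} :=
  le_antisymm hI (span_singleton_le_of_le_of_mem_sup hI hmem (C_p_not_mem_span_omega p n))

/-- The same with the hypothesis as an equality of layer ideals `I + (ω_n) = (p) + (ω_n)`. [folklore] -/
theorem eq_span_C_p_of_le_of_sup_eq {I : Ideal (IwasawaAlgebra p)}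
    (hI : I ≤ Ideal.span {(PowerSeries.C (p : ℤ_[p]) : IwasawaAlgebra p)}) (n : ℕ)
    (hsup : I ⊔ Ideal.span {omega p n} =
      Ideal.span {(PowerSeries.C (p : ℤ_[p]) : IwasawaAlgebra p)} ⊔ Ideal.span {omega p n}) :
    I = Ideal.span {(PowerSeries.C (p : ℤ_[p]) : IwasawaAlgebra p)} :=
  eq_span_C_p_of_le_of_mem_sup p hI n (hsup ▸ Ideal.mem_sup_left (Ideal.mem_span_singleton_self _))

/-- **Rigidity from the COUNT of one layer.** If `I ≤ (p)`, the layer `Λ/(I + (ω_n))` is finite and has the same cardinality as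
`Λ/((p) + (ω_n))` (`= p^{pⁿ}`: the observed `#A_n = p^{pⁿ}`), then `I = (p)`: the canonical surjection between the two quotients is
a bijection of finite sets, so the ideals agree and §3 applies. [folklore] -/
theorem eq_span_C_p_of_le_of_natCard_eq {I : Ideal (IwasawaAlgebra p)}
    (hI : I ≤ Ideal.span {(PowerSeries.C (p : ℤ_[p]) : IwasawaAlgebra p)}) (n : ℕ)
    [Finite (IwasawaAlgebra p ⧸ I ⊔ Ideal.span {omega p n})]
    (hcard : Nat.card (IwasawaAlgebra p ⧸ I ⊔ Ideal.span {omega p n}) =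
      Nat.card (IwasawaAlgebra p ⧸
        Ideal.span {(PowerSeries.C (p : ℤ_[p]) : IwasawaAlgebra p)} ⊔ Ideal.span {omega p n})) :
    I = Ideal.span {(PowerSeries.C (p : ℤ_[p]) : IwasawaAlgebra p)} := by
  set J := I ⊔ Ideal.span {omega p n} with hJ
  set K := Ideal.span {(PowerSeries.C (p : ℤ_[p]) : IwasawaAlgebra p)} ⊔ Ideal.span {omega p n} with hK
  have hJK : J ≤ K := sup_le_sup_right hI _
  -- the canonical surjection `Λ/J ↠ Λ/K`
  let φ : IwasawaAlgebra p ⧸ J →+* IwasawaAlgebra p ⧸ K := Ideal.Quotient.factor hJK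
  have hφs : Function.Surjective φ := Ideal.Quotient.factor_surjective hJK
  haveI : Finite (IwasawaAlgebra p ⧸ K) := Finite.of_surjective φ hφs
  obtain ⟨e⟩ := Finite.card_eq.mp hcard
  have hφi : Function.Injective φ := (Finite.injective_iff_surjective_of_equiv e).mpr hφs
  -- hence `K ≤ J`, in particular `p ∈ J`
  have hKJ : K ≤ J := by
    intro x hx
    have h1 : φ (Ideal.Quotient.mk J x) = 0 := by
      change Ideal.Quotient.mk K x = 0
      exact Ideal.Quotient.eq_zero_iff_mem.mpr hx
    have h2 : Ideal.Quotient.mk J x = 0 := hφi (by rw [h1, map_zero])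
    exact Ideal.Quotient.eq_zero_iff_mem.mp h2
  exact eq_span_C_p_of_le_of_mem_sup p hI n (hKJ (Ideal.mem_sup_left (Ideal.mem_span_singleton_self _)))

/-! ## §4. Consequences: all layers, and the dichotomy -/

/-- If `I = (p)` then EVERY layer ideal is `I + (ω_m) = (p, T^{p^m})` (`towerIdeal`), i.e. `Λ/(I + (ω_m)) = 𝔽_p[T]/(T^{p^m})`:
`d_m = e_m = p^m` for all `m`. [folklore] -/
theorem sup_span_omega_eq_towerIdeal_of_eq {I : Ideal (IwasawaAlgebra p)}
    (hI : I = Ideal.span {(PowerSeries.C (p : ℤ_[p]) : IwasawaAlgebra p)}) (m : ℕ) :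
    I ⊔ Ideal.span {omega p m} = towerIdeal p (p ^ m) := by
  rw [hI, span_C_p_sup_span_omega_eq_towerIdeal]

/-- The layer quotients of `Λ/(p)` as rings: `Λ/(I + (ω_m)) ≃+* Λ/(p, T^{p^m})` once `I = (p)` (so the layer counts and
`p`-ranks are those of `𝔽_p[T]/(T^{p^m})`). [folklore] -/
theorem nonempty_quotient_ringEquiv_of_eq {I : Ideal (IwasawaAlgebra p)}
    (hI : I = Ideal.span {(PowerSeries.C (p : ℤ_[p]) : IwasawaAlgebra p)}) (m : ℕ) :
    Nonempty ((IwasawaAlgebra p ⧸ I ⊔ Ideal.span {omega p m}) ≃+* (IwasawaAlgebra p ⧸ towerIdeal p (p ^ m))) :=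
  ⟨Ideal.quotEquivOfEq (sup_span_omega_eq_towerIdeal_of_eq p hI m)⟩

/-- In particular the layer COUNTS agree: `#Λ/(I + (ω_m)) = #Λ/(p, T^{p^m})` for every `m` once `I = (p)`. [folklore] -/
theorem natCard_quotient_eq_of_eq {I : Ideal (IwasawaAlgebra p)}
    (hI : I = Ideal.span {(PowerSeries.C (p : ℤ_[p]) : IwasawaAlgebra p)}) (m : ℕ) :
    Nat.card (IwasawaAlgebra p ⧸ I ⊔ Ideal.span {omega p m}) = Nat.card (IwasawaAlgebra p ⧸ towerIdeal p (p ^ m)) :=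
  Nat.card_congr (Ideal.quotEquivOfEq (sup_span_omega_eq_towerIdeal_of_eq p hI m)).toEquiv

/-- **The dichotomy behind the census reading (`D4Reading.md` items 3–4).** Let `Λ/I` be a cyclic Iwasawa module whose `n`-th layer
`Λ/(I + (ω_n))` is finite with the count of `Λ/(p, ω_n)`. Then EITHER some element of `I` is not divisible by `p` (μ = 0 for `Λ/I`, in the
tree's currency `¬ C p ∣ ·`) OR `I = (p)` — and in the latter case every layer is `Λ/(p, T^{p^m})` (`sup_span_omega_eq_towerIdeal_of_eq`).
Contrapositive, as used at `p = 2`, `n = 3`, `m = 4` for 406203s1: a layer NOT of the shape `𝔽_p[T]/(T^{p^m})` certifies μ = 0. [folklore] -/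
theorem exists_not_dvd_or_eq_span_C_p_of_natCard_eq (I : Ideal (IwasawaAlgebra p)) (n : ℕ)
    [Finite (IwasawaAlgebra p ⧸ I ⊔ Ideal.span {omega p n})]
    (hcard : Nat.card (IwasawaAlgebra p ⧸ I ⊔ Ideal.span {omega p n}) =
      Nat.card (IwasawaAlgebra p ⧸
        Ideal.span {(PowerSeries.C (p : ℤ_[p]) : IwasawaAlgebra p)} ⊔ Ideal.span {omega p n})) :
    (∃ f ∈ I, ¬ (PowerSeries.C (p : ℤ_[p]) : IwasawaAlgebra p) ∣ f) ∨
      I = Ideal.span {(PowerSeries.C (p : ℤ_[p]) : IwasawaAlgebra p)} := by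
  by_cases hI : I ≤ Ideal.span {(PowerSeries.C (p : ℤ_[p]) : IwasawaAlgebra p)}
  · exact Or.inr (eq_span_C_p_of_le_of_natCard_eq p hI n hcard)
  · left
    obtain ⟨f, hfI, hf⟩ := Set.not_subset.mp hI
    exact ⟨f, hfI, fun hdvd ↦ hf (Ideal.mem_span_singleton.mpr hdvd)⟩

end Summit.BirchSwinnertonDyer.BirchSwinnertonDyer.Theorems.SignedMuAtTwo.CyclicMuRigidity

end
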